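import Summits.Ventures.CertifiedManyBodySolver.Downfold.EmeryFermiSurfaceShape
import HarnessLib

/-!
# The doping direction of the Fermi-surface `t′/t` of the σ three-band model: a certified sign
# (companion of `EmeryFermiSurfaceShape`; INFL-dop for object E)

Venture CertifiedManyBodySolver, cell `pub/hubbard-downfold` (stage S1 = ROUTER; INFL-dop = the doping axis
of the box inflation rules), seat hubbard-downfold-mod-4 (technique B); namespace
`Summit.Ventures.CertifiedManyBodySolver.Downfold.Emery`. Everything here is PROVED (elementary real algebra).
WHAT THIS IS NOT: a statement about any material; the Fermi energies `ε₁ ≤ ε₂` of two fillings are INPUTS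
(the filling ↦ ε_F map is not closed-form); which filling is «hole-doped» is the consumer's reading
(electron picture of `EmeryFermiSurfaceShape`: removing electrons LOWERS ε_F).

By the contour theorem (`Emery.det_bloch4_eq_zero_iff_oneBand`) every constant-energy contour of the σ model
`(Δ, t_pd, t_pp, t_pp′ = c)` is a `t–t′` contour with `t′/t = fsRatio ε = −N(ε)/(D(ε) + 2N(ε))`,
`D = fsD = (Δ+ε)(t_pd² − cε)`, `N = fsN = 2t_pd²(c + t_pp) + ε(t_pp² − c²)`. How does the shape move with
the Fermi energy, i.e. with doping?

* `fsRatio_le_fsRatio_iff` — in the regime `D + 2N > 0` at both energies: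
  `fsRatio ε₁ ≤ fsRatio ε₂ ↔ N(ε₂)·D(ε₁) ≤ N(ε₁)·D(ε₂)` (the shape is a function of `q = D/N` alone,
  increasing in `q`).
* `dopingDisc` and `cross_eq_sub_mul_dopingDisc` — the exact factorisation
  `N(ε₂)D(ε₁) − N(ε₁)D(ε₂) = (ε₂ − ε₁) · dopingDisc(ε₁, ε₂)` with
  `dopingDisc = t_pd²·[(t_pp² − c²)Δ − 2(c + t_pp)(t_pd² − cΔ) + 2c(c + t_pp)(ε₁ + ε₂)] + c(t_pp² − c²)ε₁ε₂`
  (BILINEAR in `(ε₁, ε₂)`: its sign on a doping window is read at the window's corners).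
* `fsRatio_mono_of_dopingDisc_nonpos` / `fsRatio_anti_of_dopingDisc_nonneg` — THE CERTIFIED DIRECTION:
  `dopingDisc ≤ 0` ⇒ `t′/t` INCREASES with `ε` on the pair (so LOWERING ε_F — hole doping in the electron
  picture — makes the Fermi surface MORE `t′`-negative); `dopingDisc ≥ 0` ⇒ the opposite.
* the pure case `c = 0`: `dopingDisc = t_pp·t_pd²·(t_pp·Δ − 2t_pd²)` (`dopingDisc_pure`), so the direction is
  the sign of `t_pp·Δ − 2t_pd²` (`fsRatio_mono_eps_pure`, `fsRatio_anti_eps_pure`): small charge-transfer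
  energy (`t_ppΔ < 2t_pd²`, the cuprate side) ⇒ hole doping drives `t′/t` more negative; large `Δ` flips it.
-/

namespace Summit.Ventures.CertifiedManyBodySolver.Downfold.Emery

/-! ## §1 The shape comparison reduces to a cross product of the weights -/

/-- **Comparison of the Fermi-surface `t′/t` at two energies** (`D + 2N > 0` at both energies — the antibonding-sheet regime): `fsRatio ε₁ ≤ fsRatio ε₂`
iff `N₂·D₁ ≤ N₁·D₂`. [folklore] -/
theorem fsRatio_le_fsRatio_iff {Δ tpd tpp c ε₁ ε₂ : ℝ}
    (hT₁ : 0 < fsD Δ tpd c ε₁ + 2 * fsN tpd tpp c ε₁) (hT₂ : 0 < fsD Δ tpd c ε₂ + 2 * fsN tpd tpp c ε₂) :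
    fsRatio Δ tpd tpp c ε₁ ≤ fsRatio Δ tpd tpp c ε₂ ↔
      fsN tpd tpp c ε₂ * fsD Δ tpd c ε₁ ≤ fsN tpd tpp c ε₁ * fsD Δ tpd c ε₂ := by
  unfold fsRatio
  rw [neg_div, neg_div, neg_le_neg_iff, div_le_div_iff₀ hT₂ hT₁]
  constructor <;> intro h <;> nlinarith

/-- **The doping discriminant** (bilinear in the two energies):
`t_pd²·[(t_pp² − c²)Δ − 2(c + t_pp)(t_pd² − cΔ) + 2c(c + t_pp)(ε₁ + ε₂)] + c(t_pp² − c²)ε₁ε₂`. [folklore] -/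
def dopingDisc (Δ tpd tpp c ε₁ ε₂ : ℝ) : ℝ :=
  tpd ^ 2 * ((tpp ^ 2 - c ^ 2) * Δ - 2 * (c + tpp) * (tpd ^ 2 - c * Δ) + 2 * c * (c + tpp) * (ε₁ + ε₂)) +
    c * (tpp ^ 2 - c ^ 2) * (ε₁ * ε₂)

/-- The discriminant is symmetric in the two energies. [folklore] -/
theorem dopingDisc_comm (Δ tpd tpp c ε₁ ε₂ : ℝ) :
    dopingDisc Δ tpd tpp c ε₁ ε₂ = dopingDisc Δ tpd tpp c ε₂ ε₁ := by
  unfold dopingDisc; ring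

/-- **Exact factorisation of the cross product**: `N(ε₂)D(ε₁) − N(ε₁)D(ε₂) = (ε₂ − ε₁)·dopingDisc(ε₁, ε₂)`.
[folklore] -/
theorem cross_eq_sub_mul_dopingDisc (Δ tpd tpp c ε₁ ε₂ : ℝ) :
    fsN tpd tpp c ε₂ * fsD Δ tpd c ε₁ - fsN tpd tpp c ε₁ * fsD Δ tpd c ε₂ =
      (ε₂ - ε₁) * dopingDisc Δ tpd tpp c ε₁ ε₂ := by
  unfold fsN fsD dopingDisc; ring

/-- The pure (`t_pp′ = 0`) discriminant: `t_pp·t_pd²·(t_pp·Δ − 2t_pd²)`, independent of the energies. [folklore] -/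
theorem dopingDisc_pure (Δ tpd tpp ε₁ ε₂ : ℝ) :
    dopingDisc Δ tpd tpp 0 ε₁ ε₂ = tpp * tpd ^ 2 * (tpp * Δ - 2 * tpd ^ 2) := by
  unfold dopingDisc; ring

/-! ## §2 The certified direction -/

/-- **`dopingDisc ≤ 0` ⇒ the Fermi-surface `t′/t` increases with the energy** on the pair `ε₁ ≤ ε₂` (cuprate
regime at both): lowering `ε_F` makes `t′/t` more negative. [folklore] -/
theorem fsRatio_mono_of_dopingDisc_nonpos {Δ tpd tpp c ε₁ ε₂ : ℝ} (hε : ε₁ ≤ ε₂)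
    (hT₁ : 0 < fsD Δ tpd c ε₁ + 2 * fsN tpd tpp c ε₁) (hT₂ : 0 < fsD Δ tpd c ε₂ + 2 * fsN tpd tpp c ε₂)
    (hdisc : dopingDisc Δ tpd tpp c ε₁ ε₂ ≤ 0) :
    fsRatio Δ tpd tpp c ε₁ ≤ fsRatio Δ tpd tpp c ε₂ := by
  rw [fsRatio_le_fsRatio_iff hT₁ hT₂, ← sub_nonpos, cross_eq_sub_mul_dopingDisc]
  exact mul_nonpos_of_nonneg_of_nonpos (sub_nonneg.2 hε) hdisc

/-- **`dopingDisc ≥ 0` ⇒ the Fermi-surface `t′/t` decreases with the energy** on the pair `ε₁ ≤ ε₂`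
(`D + 2N > 0` at both energies — the antibonding-sheet regime): lowering `ε_F` makes `t′/t` less negative. [folklore] -/
theorem fsRatio_anti_of_dopingDisc_nonneg {Δ tpd tpp c ε₁ ε₂ : ℝ} (hε : ε₁ ≤ ε₂)
    (hT₁ : 0 < fsD Δ tpd c ε₁ + 2 * fsN tpd tpp c ε₁) (hT₂ : 0 < fsD Δ tpd c ε₂ + 2 * fsN tpd tpp c ε₂)
    (hdisc : 0 ≤ dopingDisc Δ tpd tpp c ε₁ ε₂) :
    fsRatio Δ tpd tpp c ε₂ ≤ fsRatio Δ tpd tpp c ε₁ := by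
  rw [fsRatio_le_fsRatio_iff hT₂ hT₁, ← sub_nonpos]
  have h := cross_eq_sub_mul_dopingDisc Δ tpd tpp c ε₁ ε₂
  have h' : fsN tpd tpp c ε₁ * fsD Δ tpd c ε₂ - fsN tpd tpp c ε₂ * fsD Δ tpd c ε₁ =
      -((ε₂ - ε₁) * dopingDisc Δ tpd tpp c ε₁ ε₂) := by rw [← h]; ring
  rw [h', neg_nonpos]
  exact mul_nonneg (sub_nonneg.2 hε) hdisc

/-- **Pure case, cuprate side** (`t_pp′ = 0`, `0 < t_pp`, `t_pp·Δ ≤ 2t_pd²`): `t′/t` increases with the energy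
— hole doping (lower `ε_F`) makes the Fermi surface more `t′`-negative. [folklore] -/
theorem fsRatio_mono_eps_pure {Δ tpd tpp ε₁ ε₂ : ℝ} (hε : ε₁ ≤ ε₂) (htpp : 0 < tpp)
    (hside : tpp * Δ ≤ 2 * tpd ^ 2)
    (hT₁ : 0 < fsD Δ tpd 0 ε₁ + 2 * fsN tpd tpp 0 ε₁) (hT₂ : 0 < fsD Δ tpd 0 ε₂ + 2 * fsN tpd tpp 0 ε₂) :
    fsRatio Δ tpd tpp 0 ε₁ ≤ fsRatio Δ tpd tpp 0 ε₂ := by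
  refine fsRatio_mono_of_dopingDisc_nonpos hε hT₁ hT₂ ?_
  rw [dopingDisc_pure]
  have h1 : 0 ≤ tpp * tpd ^ 2 := mul_nonneg htpp.le (sq_nonneg _)
  exact mul_nonpos_of_nonneg_of_nonpos h1 (by linarith)

/-- **Pure case, large-Δ side** (`t_pp′ = 0`, `0 < t_pp`, `2t_pd² ≤ t_pp·Δ`): `t′/t` decreases with the energy
— hole doping makes the Fermi surface LESS `t′`-negative. [folklore] -/
theorem fsRatio_anti_eps_pure {Δ tpd tpp ε₁ ε₂ : ℝ} (hε : ε₁ ≤ ε₂) (htpp : 0 < tpp)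
    (hside : 2 * tpd ^ 2 ≤ tpp * Δ)
    (hT₁ : 0 < fsD Δ tpd 0 ε₁ + 2 * fsN tpd tpp 0 ε₁) (hT₂ : 0 < fsD Δ tpd 0 ε₂ + 2 * fsN tpd tpp 0 ε₂) :
    fsRatio Δ tpd tpp 0 ε₂ ≤ fsRatio Δ tpd tpp 0 ε₁ := by
  refine fsRatio_anti_of_dopingDisc_nonneg hε hT₁ hT₂ ?_
  rw [dopingDisc_pure]
  have h1 : 0 ≤ tpp * tpd ^ 2 := mul_nonneg htpp.le (sq_nonneg _)
  exact mul_nonneg h1 (by linarith)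

/-- **Bilinear corner rule for the discriminant's sign on a doping window**: `dopingDisc` is affine in each
energy separately, so on `[a, b] ∋ ε₁, ε₂` it is `≤ 0` as soon as it is `≤ 0` at the four corners
`(a,a), (a,b), (b,a), (b,b)`. [folklore] -/
theorem dopingDisc_nonpos_of_corners {Δ tpd tpp c a b ε₁ ε₂ : ℝ} (h₁ : ε₁ ∈ Set.Icc a b) (h₂ : ε₂ ∈ Set.Icc a b)
    (haa : dopingDisc Δ tpd tpp c a a ≤ 0) (hab : dopingDisc Δ tpd tpp c a b ≤ 0)
    (hba : dopingDisc Δ tpd tpp c b a ≤ 0) (hbb : dopingDisc Δ tpd tpp c b b ≤ 0) :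
    dopingDisc Δ tpd tpp c ε₁ ε₂ ≤ 0 := by
  rcases h₁ with ⟨ha₁, hb₁⟩
  rcases h₂ with ⟨ha₂, hb₂⟩
  by_cases hab' : a = b
  · subst hab'
    have e1 : ε₁ = a := le_antisymm hb₁ ha₁
    have e2 : ε₂ = a := le_antisymm hb₂ ha₂
    subst e1; subst e2; exact haa
  have hlt : a < b := lt_of_le_of_ne (le_trans ha₁ hb₁) hab'
  -- barycentric weights
  set l₁ := (b - ε₁) / (b - a) with hl₁
  set m₁ := (ε₁ - a) / (b - a) with hm₁
  set l₂ := (b - ε₂) / (b - a) with hl₂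
  set m₂ := (ε₂ - a) / (b - a) with hm₂
  have hba0 : 0 < b - a := sub_pos.2 hlt
  have hl₁0 : 0 ≤ l₁ := div_nonneg (by linarith) hba0.le
  have hm₁0 : 0 ≤ m₁ := div_nonneg (by linarith) hba0.le
  have hl₂0 : 0 ≤ l₂ := div_nonneg (by linarith) hba0.le
  have hm₂0 : 0 ≤ m₂ := div_nonneg (by linarith) hba0.le
  have hs₁ : l₁ + m₁ = 1 := by rw [hl₁, hm₁, ← add_div, div_eq_one_iff_eq hba0.ne']; ring
  have hs₂ : l₂ + m₂ = 1 := by rw [hl₂, hm₂, ← add_div, div_eq_one_iff_eq hba0.ne']; ring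
  have he₁ : ε₁ = l₁ * a + m₁ * b := by
    rw [hl₁, hm₁]; field_simp; ring
  have he₂ : ε₂ = l₂ * a + m₂ * b := by
    rw [hl₂, hm₂]; field_simp; ring
  have key : dopingDisc Δ tpd tpp c ε₁ ε₂ =
      l₁ * l₂ * dopingDisc Δ tpd tpp c a a + l₁ * m₂ * dopingDisc Δ tpd tpp c a b +
        m₁ * l₂ * dopingDisc Δ tpd tpp c b a + m₁ * m₂ * dopingDisc Δ tpd tpp c b b := by
    have E1 : m₁ = 1 - l₁ := by linarith
    have E2 : m₂ = 1 - l₂ := by linarith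
    rw [he₁, he₂, E1, E2]
    unfold dopingDisc; ring
  rw [key]
  have t1 := mul_nonpos_of_nonneg_of_nonpos (mul_nonneg hl₁0 hl₂0) haa
  have t2 := mul_nonpos_of_nonneg_of_nonpos (mul_nonneg hl₁0 hm₂0) hab
  have t3 := mul_nonpos_of_nonneg_of_nonpos (mul_nonneg hm₁0 hl₂0) hba
  have t4 := mul_nonpos_of_nonneg_of_nonpos (mul_nonneg hm₁0 hm₂0) hbb
  linarith

end Summit.Ventures.CertifiedManyBodySolver.Downfold.Emery
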